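import Summits.HodgeConjecture.HodgeConjecture.Theorems.Ring2WeilCoverageNormCriteria
import Summits.HodgeConjecture.HodgeConjecture.Theorems.Ring2WeilNormObstructionDescentCensus
import HarnessLib

/-!
# Weil-type family coverage — norm classes of the `SL₂(7)`-carrier data over `ℚ(√-7)` (ring2-b06, gen 100)

research route conditional on HC_CM; not a corollary; Q11.4-sentence-2 already refuted in dim ≥ 3.

Ring 2, WEIL-TYPE FAMILY-COVERAGE CENSUS (`HOME/WEIL-FAMILY-COVERAGE.md`, section `## b06`, block b06.22, owner
ring2-b06).  Block b06.22 introduces a new carrier for `K = ℚ(√-7)`: the group `SL₂(7)` with one of its two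
faithful 4-dimensional characters `ψ` (`ℚ(ψ) = ℚ(√-7)`), alone and in the product windows `SL₂(7) × S₃`,
`SL₂(7) × S₅`; the hidden factor of each admissible branch datum is read exactly on a coset cover (integer `H¹`,
Hecke operator `X = S_{7A} - S_{7B}` with `X² = -252` on the `ψ`-part, exact hermitian layer).  Those are exact
topological computations of the census, not kernel statements.  THIS FILE pins the ARITHMETIC of the literal
determinants `det_K H` the engine returns, i.e. the class of each in `ℚˣ/Nm(ℚ(√-7)ˣ)` and its position relative
to the split class `[(-1)ⁿ]` of van Geemen's normal form:

* the six rigid `SL₂(7) × S₃` sixfold data `(0; 14A:2, 6:3, 7B:2)`, `(0; 14B:2, 6:3, 7A:2)` (genus 697) and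
  `(0; 14X:2, 7Y:2, 8Z:3)` (genus 823): `det_K H ∈ {-2¹²·3³, -2¹³·3³, -2¹⁴·3³, -2¹⁵·3³}` — each class is `[-3]`,
  NOT the split class of `(3, ℚ(√-7))`: row W6.7.3 = `(3, ℚ(√-7), a ≡ 3)` (pub-hsemireg R4);
* the two rigid `SL₂(7) × S₅` sixfold data `(0; 3:32, 4:4, 7A:3)` / `(…, 7B:3)` (genus 10 801):
  `det_K H = -2¹⁴·5`, `-2¹³·5` — class `[-5]`, NOT split: row W6.7.5 = `(3, ℚ(√-7), a ≡ 5)` (R4);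
* two SPLIT instances of the carrier alone (THEOREM S7's prediction `[n]^{r₁} = [1]` for the carrier alone):
  the rigid fourfold datum `(0; 14B, 4, 6)` (genus 87, `det_K H = 2⁴`) and the Hodge-generic one-parameter
  fourfold family `(0; 3, 3, 4, 6)` (genus 155, `det_K H = 2⁵ = 5² + 7·1²`): class `[1] = [(-1)²]`, row W4.7.1.

The non-split statements are the tree's `negThree_ne_split_seven_of_odd` / `negFive_ne_split_seven_of_odd`
(`3, 5 ∉ Nm(ℚ(√-7)ˣ)`, ring2-b02's uniform descent); the norm witnesses are explicit (`x² + 7y²`).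

No `def`, no named fact, no `sorry`; nothing here is a statement about Hodge classes; `HC_CM` is used nowhere.

References: [cite: vanGeemen1994HodgeAV, 5.2 and (5.4.1)].
-/

noncomputable section

set_option linter.dupNamespace false

open Literature.AlgebraicGeometry.Motives
open Literature.AlgebraicGeometry.VanGeemen1994
open Summit.HodgeConjecture.HodgeConjecture.Ring2.Hypotheses
open Summit.HodgeConjecture.Ring2WeilNormDescent

namespace Summit.HodgeConjecture.HodgeConjecture.Ring2.WeilCoverage

/-! ### `SL₂(7) × S₃` on W6.7.3 = `(3, ℚ(√-7), a ≡ 3)` — the six rigid data (four literal determinants) -/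

/-- **`(0; 14A:2, 6:3, 7B:2)` (genus 697; coset cover of genus 14; `ℚ(√-7)`-signature `(3,3)`): literal
`det_K H = -2¹²·3³ = -110592`; `(-110592)⁻¹·(-3) = 1/36864 = (1/192)²` is a norm from `ℚ(√-7)`, so the class is `[-3]`.**
research route conditional on HC_CM; not a corollary; Q11.4-sentence-2 already refuted in dim ≥ 3. [cite: vanGeemen1994HodgeAV, (5.4.1)] -/
theorem sl27xS3_14A_6_7B_mk_detH_eq_negThree :
    (QuotientGroup.mk (Units.mk0 (-110592 : ℚ) (by norm_num)) : weilNormResidueGroup 7) =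
      QuotientGroup.mk (Units.mk0 (-3 : ℚ) (by norm_num)) := by
  rw [QuotientGroup.eq]
  have e : (Units.mk0 (-110592 : ℚ) (by norm_num))⁻¹ * Units.mk0 (-3 : ℚ) (by norm_num) =
      Units.mk0 ((1 : ℚ) / 36864) (by norm_num) := Units.ext (by norm_num)
  rw [e]
  exact mem_normUnitsSubgroup_of_sq_add_mul_sq _ ((1 : ℚ) / 192) 0 (by norm_num)

/-- … hence NOT the split class `[(-1)³]` of `(3, ℚ(√-7))`: the hidden factor of `(0; 14A:2, 6:3, 7B:2)` lies on the
non-split row W6.7.3 (`negThree_ne_split_seven_of_odd`: `3 ∉ Nm(ℚ(√-7)ˣ)`).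
research route conditional on HC_CM; not a corollary; Q11.4-sentence-2 already refuted in dim ≥ 3. [cite: vanGeemen1994HodgeAV, (5.4.1)] -/
theorem sl27xS3_14A_6_7B_mk_detH_ne_split :
    (QuotientGroup.mk (Units.mk0 (-110592 : ℚ) (by norm_num)) : weilNormResidueGroup 7) ≠
      splitDiscriminantClass 3 7 := by
  rw [sl27xS3_14A_6_7B_mk_detH_eq_negThree]
  exact negThree_ne_split_seven_of_odd (by decide)

/-- **`(0; 14B:2, 6:3, 7A:2)` (genus 697) and `(0; 14A:2, 7B:2, 8A:3)` (genus 823): literal `det_K H = -2¹³·3³ = -221184`;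
`(-221184)⁻¹·(-3) = 1/73728 = (1/768)² + 7·(1/768)²`, so the class is `[-3]`.**
research route conditional on HC_CM; not a corollary; Q11.4-sentence-2 already refuted in dim ≥ 3. [cite: vanGeemen1994HodgeAV, (5.4.1)] -/
theorem sl27xS3_detH_2pow13_mk_eq_negThree :
    (QuotientGroup.mk (Units.mk0 (-221184 : ℚ) (by norm_num)) : weilNormResidueGroup 7) =
      QuotientGroup.mk (Units.mk0 (-3 : ℚ) (by norm_num)) := by
  rw [QuotientGroup.eq]
  have e : (Units.mk0 (-221184 : ℚ) (by norm_num))⁻¹ * Units.mk0 (-3 : ℚ) (by norm_num) =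
      Units.mk0 ((1 : ℚ) / 73728) (by norm_num) := Units.ext (by norm_num)
  rw [e]
  exact mem_normUnitsSubgroup_of_sq_add_mul_sq _ ((1 : ℚ) / 768) ((1 : ℚ) / 768) (by norm_num)

/-- … hence NOT the split class: `(0; 14B:2, 6:3, 7A:2)` and `(0; 14A:2, 7B:2, 8A:3)` lie on W6.7.3.
research route conditional on HC_CM; not a corollary; Q11.4-sentence-2 already refuted in dim ≥ 3. [cite: vanGeemen1994HodgeAV, (5.4.1)] -/
theorem sl27xS3_detH_2pow13_mk_ne_split :
    (QuotientGroup.mk (Units.mk0 (-221184 : ℚ) (by norm_num)) : weilNormResidueGroup 7) ≠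
      splitDiscriminantClass 3 7 := by
  rw [sl27xS3_detH_2pow13_mk_eq_negThree]
  exact negThree_ne_split_seven_of_odd (by decide)

/-- **`(0; 14A:2, 7B:2, 8B:3)` and `(0; 14B:2, 7A:2, 8A:3)` (genus 823; coset cover of genus 17): literal
`det_K H = -2¹⁴·3³ = -442368`; `(-442368)⁻¹·(-3) = 1/147456 = (1/384)²`, so the class is `[-3]`.**
research route conditional on HC_CM; not a corollary; Q11.4-sentence-2 already refuted in dim ≥ 3. [cite: vanGeemen1994HodgeAV, (5.4.1)] -/
theorem sl27xS3_detH_2pow14_mk_eq_negThree :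
    (QuotientGroup.mk (Units.mk0 (-442368 : ℚ) (by norm_num)) : weilNormResidueGroup 7) =
      QuotientGroup.mk (Units.mk0 (-3 : ℚ) (by norm_num)) := by
  rw [QuotientGroup.eq]
  have e : (Units.mk0 (-442368 : ℚ) (by norm_num))⁻¹ * Units.mk0 (-3 : ℚ) (by norm_num) =
      Units.mk0 ((1 : ℚ) / 147456) (by norm_num) := Units.ext (by norm_num)
  rw [e]
  exact mem_normUnitsSubgroup_of_sq_add_mul_sq _ ((1 : ℚ) / 384) 0 (by norm_num)

/-- … hence NOT the split class: `(0; 14A:2, 7B:2, 8B:3)` and `(0; 14B:2, 7A:2, 8A:3)` lie on W6.7.3.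
research route conditional on HC_CM; not a corollary; Q11.4-sentence-2 already refuted in dim ≥ 3. [cite: vanGeemen1994HodgeAV, (5.4.1)] -/
theorem sl27xS3_detH_2pow14_mk_ne_split :
    (QuotientGroup.mk (Units.mk0 (-442368 : ℚ) (by norm_num)) : weilNormResidueGroup 7) ≠
      splitDiscriminantClass 3 7 := by
  rw [sl27xS3_detH_2pow14_mk_eq_negThree]
  exact negThree_ne_split_seven_of_odd (by decide)

/-- **`(0; 14B:2, 7A:2, 8B:3)` (genus 823): literal `det_K H = -2¹⁵·3³ = -884736`;
`(-884736)⁻¹·(-3) = 1/294912 = (1/1536)² + 7·(1/1536)²`, so the class is `[-3]`.**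
research route conditional on HC_CM; not a corollary; Q11.4-sentence-2 already refuted in dim ≥ 3. [cite: vanGeemen1994HodgeAV, (5.4.1)] -/
theorem sl27xS3_detH_2pow15_mk_eq_negThree :
    (QuotientGroup.mk (Units.mk0 (-884736 : ℚ) (by norm_num)) : weilNormResidueGroup 7) =
      QuotientGroup.mk (Units.mk0 (-3 : ℚ) (by norm_num)) := by
  rw [QuotientGroup.eq]
  have e : (Units.mk0 (-884736 : ℚ) (by norm_num))⁻¹ * Units.mk0 (-3 : ℚ) (by norm_num) =
      Units.mk0 ((1 : ℚ) / 294912) (by norm_num) := Units.ext (by norm_num)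
  rw [e]
  exact mem_normUnitsSubgroup_of_sq_add_mul_sq _ ((1 : ℚ) / 1536) ((1 : ℚ) / 1536) (by norm_num)

/-- … hence NOT the split class: `(0; 14B:2, 7A:2, 8B:3)` lies on W6.7.3.
research route conditional on HC_CM; not a corollary; Q11.4-sentence-2 already refuted in dim ≥ 3. [cite: vanGeemen1994HodgeAV, (5.4.1)] -/
theorem sl27xS3_detH_2pow15_mk_ne_split :
    (QuotientGroup.mk (Units.mk0 (-884736 : ℚ) (by norm_num)) : weilNormResidueGroup 7) ≠
      splitDiscriminantClass 3 7 := by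
  rw [sl27xS3_detH_2pow15_mk_eq_negThree]
  exact negThree_ne_split_seven_of_odd (by decide)

/-! ### `SL₂(7) × S₅` on W6.7.5 = `(3, ℚ(√-7), a ≡ 5)` — the rigid conjugate pair of genus 10 801 -/

/-- **`(0; 3:32, 4:4, 7A:3)` (genus 10 801; 80-sheet coset cover of genus 13; `ℚ(√-7)`-signature `(3,3)`): literal
`det_K H = -2¹⁴·5 = -81920`; `(-81920)⁻¹·(-5) = 1/16384 = (1/128)²`, so the class is `[-5]`.**
research route conditional on HC_CM; not a corollary; Q11.4-sentence-2 already refuted in dim ≥ 3. [cite: vanGeemen1994HodgeAV, (5.4.1)] -/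
theorem sl27xS5_3_4_7A_mk_detH_eq_negFive :
    (QuotientGroup.mk (Units.mk0 (-81920 : ℚ) (by norm_num)) : weilNormResidueGroup 7) =
      QuotientGroup.mk (Units.mk0 (-5 : ℚ) (by norm_num)) := by
  rw [QuotientGroup.eq]
  have e : (Units.mk0 (-81920 : ℚ) (by norm_num))⁻¹ * Units.mk0 (-5 : ℚ) (by norm_num) =
      Units.mk0 ((1 : ℚ) / 16384) (by norm_num) := Units.ext (by norm_num)
  rw [e]
  exact mem_normUnitsSubgroup_of_sq_add_mul_sq _ ((1 : ℚ) / 128) 0 (by norm_num)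

/-- … hence NOT the split class `[(-1)³]`: the hidden factor of `(0; 3:32, 4:4, 7A:3)` lies on the non-split row
W6.7.5 (`negFive_ne_split_seven_of_odd`: `5 ∉ Nm(ℚ(√-7)ˣ)`).
research route conditional on HC_CM; not a corollary; Q11.4-sentence-2 already refuted in dim ≥ 3. [cite: vanGeemen1994HodgeAV, (5.4.1)] -/
theorem sl27xS5_3_4_7A_mk_detH_ne_split :
    (QuotientGroup.mk (Units.mk0 (-81920 : ℚ) (by norm_num)) : weilNormResidueGroup 7) ≠
      splitDiscriminantClass 3 7 := by
  rw [sl27xS5_3_4_7A_mk_detH_eq_negFive]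
  exact negFive_ne_split_seven_of_odd (by decide)

/-- **`(0; 3:32, 4:4, 7B:3)` (genus 10 801): literal `det_K H = -2¹³·5 = -40960`;
`(-40960)⁻¹·(-5) = 1/8192 = (1/256)² + 7·(1/256)²`, so the class is `[-5]`.**
research route conditional on HC_CM; not a corollary; Q11.4-sentence-2 already refuted in dim ≥ 3. [cite: vanGeemen1994HodgeAV, (5.4.1)] -/
theorem sl27xS5_3_4_7B_mk_detH_eq_negFive :
    (QuotientGroup.mk (Units.mk0 (-40960 : ℚ) (by norm_num)) : weilNormResidueGroup 7) =
      QuotientGroup.mk (Units.mk0 (-5 : ℚ) (by norm_num)) := by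
  rw [QuotientGroup.eq]
  have e : (Units.mk0 (-40960 : ℚ) (by norm_num))⁻¹ * Units.mk0 (-5 : ℚ) (by norm_num) =
      Units.mk0 ((1 : ℚ) / 8192) (by norm_num) := Units.ext (by norm_num)
  rw [e]
  exact mem_normUnitsSubgroup_of_sq_add_mul_sq _ ((1 : ℚ) / 256) ((1 : ℚ) / 256) (by norm_num)

/-- … hence NOT the split class: the hidden factor of `(0; 3:32, 4:4, 7B:3)` lies on W6.7.5.
research route conditional on HC_CM; not a corollary; Q11.4-sentence-2 already refuted in dim ≥ 3. [cite: vanGeemen1994HodgeAV, (5.4.1)] -/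
theorem sl27xS5_3_4_7B_mk_detH_ne_split :
    (QuotientGroup.mk (Units.mk0 (-40960 : ℚ) (by norm_num)) : weilNormResidueGroup 7) ≠
      splitDiscriminantClass 3 7 := by
  rw [sl27xS5_3_4_7B_mk_detH_eq_negFive]
  exact negFive_ne_split_seven_of_odd (by decide)

/-! ### The carrier alone on W4.7.1 = `(2, ℚ(√-7), a ≡ 1)` — two split instances (S7: `[n]^{r₁} = [1]`) -/

/-- **`(0; 14B, 4, 6)` (genus 87, the smallest rigid `SL₂(7)`-curve whose `ψ`-piece is a `(2,2)` Weil-type fourfold;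
coset cover `C̃/(7:3)` of genus 4): literal `det_K H = 2⁴ = 16 = 4² + 7·0²` is a norm, so the class is the split class
`[(-1)²] = [1]` (`mk_eq_splitDiscriminantClass_iff_of_even`).**
research route conditional on HC_CM; not a corollary; Q11.4-sentence-2 already refuted in dim ≥ 3. [cite: vanGeemen1994HodgeAV, (5.4.1)] -/
theorem sl27_14B_4_6_mk_detH_eq_split :
    (QuotientGroup.mk (Units.mk0 (16 : ℚ) (by norm_num)) : weilNormResidueGroup 7) =
      splitDiscriminantClass 2 7 :=
  (mk_eq_splitDiscriminantClass_iff_of_even (by decide) _).2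
    (mem_normUnitsSubgroup_of_sq_add_mul_sq _ (4 : ℚ) 0 (by norm_num))

/-- **`(0; 3, 3, 4, 6)` (genus 155; the smallest Hodge-generic one-parameter family of the carrier alone, exact
unipotent Lie closure `15 = dim 𝔰𝔲(2,2)` in the census): literal `det_K H = 2⁵ = 32 = 5² + 7·1²` is a norm, so the
class is the split class `[1]` — row W4.7.1, where `W_K` is algebraic for every member by the refereed literature
cited in the census (b01.2), which this file does not restate.**
research route conditional on HC_CM; not a corollary; Q11.4-sentence-2 already refuted in dim ≥ 3. [cite: vanGeemen1994HodgeAV, (5.4.1)] -/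
theorem sl27_3_3_4_6_family_mk_detH_eq_split :
    (QuotientGroup.mk (Units.mk0 (32 : ℚ) (by norm_num)) : weilNormResidueGroup 7) =
      splitDiscriminantClass 2 7 :=
  (mk_eq_splitDiscriminantClass_iff_of_even (by decide) _).2
    (mem_normUnitsSubgroup_of_sq_add_mul_sq _ (5 : ℚ) 1 (by norm_num))

end Summit.HodgeConjecture.HodgeConjecture.Ring2.WeilCoverage

end
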